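import Summits.BirchSwinnertonDyer.BirchSwinnertonDyer.Theorems.AdditiveKolyvaginRoadLevelKolyvaginSystemsAdditivePoitouTateFree
import HarnessLib

/-!
# Route `AdditiveKolyvaginRoad`, crux r2 `KolyvaginPrimitiveAdditive` (item stmt-BirchSwinnertonDyer-21400, KPA′):
# REGISTERED STUB J2 `stub_twoPrimeJumpAdditive` of line `birth` (skeleton v10, sha16 7e88b0632f34f05f) — LANDED BY NAME, unconditionally
# (cell `pub/bsd-wall`, width seat `bsd-wall-akr-p2x-w3` g10; `--supports stmt-BirchSwinnertonDyer-21400`, stub credit; pointer of akr-p2x-w4 g3)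

WHY. The registry of crux r2 KPA′ (stmt-BirchSwinnertonDyer-21400) is skeleton `birth` v10 with four stubs {P, J2, KS, LOC}. Two of them are
E-side and ALREADY THEOREMS of the tree once the Poitou–Tate fact for Selmer structures is the kernel-checked
`SchneiderFreeAdditiveX3.PoitouTateReduction.poitouTate_selmerStructure_duality_holds` (cell bsd-schneider, p624636): J2 is
`AdditiveKoly.twoPrimeJump` (akr-p2x-w4 g2, `…LevelKolyvaginSystemsAdditivePoitouTateFree.lean` §5, p635192) — conclusion token-identical,
hypotheses a subset of the stub's frame binders. This file records the registered signature VERBATIM under the skeleton's namespace, so that the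
registry of 21400 reads {P (Gross–Zagier–Kolyvagin ∕ Cassels–Tate shaped), KS (= crux KS′ stmt-BirchSwinnertonDyer-21396)} and nothing else:
the deadlock of record 21396 ⇄ 21400 is then exactly the research residual (Kolyvagin's conjecture mod `p` above the bottom at an additive
prime `p ≥ 5`).

WHAT. `…Cruxes.KolyvaginPrimitiveAdditive.Birth.stub_twoPrimeJumpAdditive` — at every ♯ additive frame, for complex conjugation `c ≠ 1` and the
`ZMod p`-structure of `H¹(K, E[p])`: if the level-`∅` canonical space `Sel_∅^ε` is the line through `x` and `q₁ ≠ q₂` are Bertolini–Darmon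
admissible primes whose places `v₁, v₂` both detect `x`, then `dim_{𝔽_p} Sel_{q₁q₂}^ε = 1` and `Sel_{q₁q₂}^{¬ε} = Sel_∅^{¬ε}` (W. Zhang 2014
Lemma 5.3 ∕ Prop. 5.4, raising half, twice). Proof: `AdditiveKoly.twoPrimeJump` (only `5 ≤ p`, `K` imaginary quadratic, `c ≠ 1` are used;
the other fourteen frame binders are idle, kept because the registered text has them).

HONEST FRAMING: one theorem, no definition, no named fact, no `sorry`; standard axioms. It closes STUB J2 of 21400's registry by name and
nothing else; crux r2 KPA′ and crux KS′ stay OPEN (their common residual is research, in print only for `p ∤ N`). BSD is not proved by this.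

References: [cite: WZhang2014, Lemma 5.3, Prop. 5.4, §9 (9.2)] [cite: MilneADT2006, Ch. I, Thm. 4.10 (b)] [cite: KlagsbrunMazurRubin2013, Thm. 3.1 (i)].
-/

-- single-conjunct summit: `Summit.BirchSwinnertonDyer.BirchSwinnertonDyer.…` repeats the name by design
set_option linter.dupNamespace false

noncomputable section

open scoped Classical

namespace Summit.BirchSwinnertonDyer.BirchSwinnertonDyer.Cruxes.KolyvaginPrimitiveAdditive.Birth

open WeierstrassCurve NumberField IsDedekindDomain Literature.NumberTheory.EllipticCurves
  Literature.NumberTheory.EllipticCurves.ModularForms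
  Literature.NumberTheory.EllipticCurves.Rank1Residual
  Literature.NumberTheory.GaloisRepresentations
  Summit.BirchSwinnertonDyer.Rank1Residual
  Summit.BirchSwinnertonDyer.BirchSwinnertonDyer.Theorems.AdditiveKoly Module

/-- **STUB J2 of crux r2's line `birth` (v10), by name — the two-prime Poitou–Tate jump at Bertolini–Darmon admissible primes, unconditionally.**
At every ♯ additive frame, for complex conjugation `c ≠ 1` and the `ZMod p`-structure of `H¹(K, E[p])`: if the level-`∅` canonical space
`Sel_∅^ε` is the line through `x` and `q₁ ≠ q₂` are admissible primes whose places `v₁, v₂` both DETECT `x` (`loc_{v_i} x ≠ 0`), then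
`dim_{𝔽_p} Sel_{q₁q₂}^ε = 1` and `Sel_{q₁q₂}^{¬ε} = Sel_∅^{¬ε}`. = `AdditiveKoly.twoPrimeJump` (p635192, at the Poitou–Tate theorem p624636);
registered signature verbatim. [cite: WZhang2014, Lemma 5.3, Prop. 5.4, §9 (9.2)] [cite: MilneADT2006, Ch. I, Thm. 4.10 (b)]
[cite: KlagsbrunMazurRubin2013, Thm. 3.1 (i)] -/
theorem stub_twoPrimeJumpAdditive :
  ∀ (W : WeierstrassCurve ℚ) [W.IsElliptic] [W.IsGloballyMinimal] [NeZero (W.conductorNorm ℤ)]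
    (p : ℕ) [Fact p.Prime] (K : Type) [Field K] [NumberField K]
    (Dt : ModularParametrizationData W (W.conductorNorm ℤ)) (β : ℤ) (ι : K →+* ℂ),
    5 ≤ p → Addv W p → W.HasSurjectiveModNGaloisRep p →
    (∀ (ℓ : ℕ) [Fact ℓ.Prime], W.HasMultiplicativeReductionAtPrime ℓ →
      ¬ p ∣ padicValInt ℓ W.minimalDiscriminantInt) →
    (∃ (ℓ₁ ℓ₂ : ℕ) (_ : Fact ℓ₁.Prime) (_ : Fact ℓ₂.Prime), ℓ₁ ≠ ℓ₂ ∧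
      W.HasMultiplicativeReductionAtPrime ℓ₁ ∧ W.HasMultiplicativeReductionAtPrime ℓ₂) →
    ¬ p ∣ W.tamagawaProduct → W.analyticRank = 1 →
    IsImaginaryQuadratic K → Odd (NumberField.discr K) → NumberField.discr K < -4 →
    SatisfiesHeegnerHypothesis (W.conductorNorm ℤ) K →
    (W.quadraticTwist (NumberField.discr K : ℚ)).entireLFunction 1 ≠ 0 →
    (4 * (W.conductorNorm ℤ : ℤ)) ∣ β ^ 2 - NumberField.discr K → ¬ (p : ℤ) ∣ Dt.c →
    ∀ (c : K ≃ₐ[ℚ] K), c ≠ 1 → ∀ [Module (ZMod p) (Vp W K p)],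
    ∀ (ε : Bool) (x : Vp W K p) (q₁ q₂ : AdmQ W K p) (v₁ v₂ : HeightOneSpectrum (𝓞 K)),
      x ∈ SelQP W K p c ∅ ε → x ≠ 0 → (∀ y ∈ SelQP W K p c ∅ ε, ∃ a : ZMod p, y = a • x) → q₁ ≠ q₂ →
      ((q₁ : ℕ) : 𝓞 K) ∈ v₁.asIdeal →
      x ∉ (W.baseChange K).torsionLocalKer (v₁.adicCompletion K) ((p ^ 1 : ℕ) : ℤ) →
      ((q₂ : ℕ) : 𝓞 K) ∈ v₂.asIdeal →
      x ∉ (W.baseChange K).torsionLocalKer (v₂.adicCompletion K) ((p ^ 1 : ℕ) : ℤ) →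
      finrank (ZMod p) (SelQP W K p c {q₁, q₂} ε) = 1 ∧
        SelQP W K p c {q₁, q₂} (!ε) = SelQP W K p c ∅ (!ε) := by
  intro W _ _ _ p _ K _ _ Dt β ι h5 _ _ _ _ _ _ hK _ _ _ _ _ _ c hc1 _
  exact twoPrimeJump W K p c h5 hK hc1

end Summit.BirchSwinnertonDyer.BirchSwinnertonDyer.Cruxes.KolyvaginPrimitiveAdditive.Birth

end
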